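import Summits.Ventures.YMGap.YM3IR.ForestHaar
import Literature.MathematicalPhysics.QuantumFieldTheory.FlatLatticeGaugeFields

/-!
# YM3IR / ForestDisintegration — the Wilson law DISINTEGRATES along a gauge forest (kernel proof)

HONEST FRAMING.  Folklore measure theory of the tree / axial gauge (Creutz, *Quarks, Gluons and Lattices* eq. (9.19);
Montvay–Münster, *Quantum Fields on a Lattice* §3.2.5), typed for this cell's track Y4 audit of `IRConjecture3`
(`YM3IR/ForestAudit.lean`, `YM3IR/ForestHaar.lean`).  NOTHING here is about Yang–Mills dynamics: no mass gap, no
continuum statement, no smallness, no locality estimate, no claim on any conjecture-labelled item.  What it adds to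
`ForestHaar.lean` (forest marginal = product Haar) is the JOINT structure: the forest field is INDEPENDENT of the
forest gauge fixing, and conditional expectations / covariances given the forest are EXPLICIT forest averages —
i.e. the exact objects that clauses (b)(ii) / (b)(i) of `IRConjecture3` speak about, for the forest block family
`forestFamily` (whose block MAP is not gauge-covariant — theory-1's `YM3IR/CovariantFamily.lean`).

CONTENT (torus of side `b·M`, `2 ≤ b`, every `M ≥ 1`, every `β`, continuous `ρ`, compact second-countable `G`):
* `forestFix` — the forest (axial) gauge fixing `U ↦ U^{leafGauge (starDecimation U)⁻¹}`; all star links become `1`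
  (`starDecimation_forestFix`); it is invariant under leaf rotations (`forestFix_gaugeTransform_leafGauge`) and
  `U = (forestFix U)^{leafGauge (starDecimation U)}` (`gaugeTransform_leafGauge_forestFix`, reconstruction).
* `map_forestFix_prod_starDecimation_wilsonMeasure` — INDEPENDENCE:
  `law(forestFix U, starDecimation U) = law(forestFix U) ⊗ Haar^{⊗E(M)}` under the Wilson law (slices of the joint
  law are right-invariant finite measures in the forest field ⇒ multiples of product Haar:
  `eq_of_isMulRightInvariant_of_measure_univ_eq`, Mathlib `haarMeasure_unique`, `Measure.prod_eq`).
* `condExp_forest_ae_eq_forestAverage` — `E[f | σ(starDecimation)] = Ψ_f ∘ starDecimation` a.s., with the FOREST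
  AVERAGE `forestAverage … f s = ∫ f(a^{leafGauge s}) d law(forestFix U)(a)` (Fubini on the product form + the
  characterisation `ae_eq_condExp_of_forall_setIntegral_eq`); `condCov_forest_ae_eq_forestCov` — the conditional
  covariance is the forest covariance `forestCov`; both re-phrased with the tree's `coarseSigma` / `fineLaw` /
  `condCov` of `forestFamily` (`condExp_coarseSigma_forestFamily_ae_eq`, `condCov_forestFamily_ae_eq`).

USE (cell-internal).  Clause (b) of `IRConjecture3` for the forest family thereby reduces to decay / quasi-locality of
`forestCov` / `forestAverage` in the forest field (the `@[conjecture] ForestWitness3` of `ForestAudit.lean`; NOT proved here).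
References: Creutz (CUP 1983) eq. (9.19); Montvay–Münster (CUP 1994) §3.2.5; K. Wilson, Phys. Rev. D 10 (1974) 2445 §III.B
[cite: Wilson1974]; cell files ym3ir/AUDIT-theory2-g4.md §2.3–2.4, ym3ir/YM3-IR-theory2.md §9.
-/

noncomputable section

open MeasureTheory ProbabilityTheory
open Literature.MathematicalPhysics.QuantumLattice Literature.MathematicalPhysics.QuantumFieldTheory

namespace Summit.Ventures.YMGap.YM3IR

section HaarUniquenessFinite
variable {K : Type*} [Group K] [TopologicalSpace K] [IsTopologicalGroup K] [CompactSpace K]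
  [MeasurableSpace K] [BorelSpace K] [SecondCountableTopology K]

/-- On a compact second-countable group, two RIGHT-invariant FINITE measures with the same total mass
coincide (`μ.inv` is left-invariant; Mathlib `haarMeasure_unique`). [folklore] -/
theorem eq_of_isMulRightInvariant_of_measure_univ_eq (μ ν : Measure K) [IsFiniteMeasure μ]
    [IsFiniteMeasure ν] [μ.IsMulRightInvariant] [ν.IsMulRightInvariant]
    (h : μ Set.univ = ν Set.univ) : μ = ν := by
  have key : ∀ (μ : Measure K) [IsFiniteMeasure μ] [μ.IsMulRightInvariant],
      μ.inv = μ Set.univ • Measure.haarMeasure (⊤ : TopologicalSpace.PositiveCompacts K) := by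
    intro μ _ _
    haveI : IsFiniteMeasure μ.inv :=
      ⟨by rw [Measure.inv_apply, Set.inv_univ]; exact measure_lt_top _ _⟩
    have h := Measure.haarMeasure_unique μ.inv (⊤ : TopologicalSpace.PositiveCompacts K)
    rw [TopologicalSpace.PositiveCompacts.coe_top, Measure.inv_apply, Set.inv_univ] at h
    exact h
  rw [← Measure.inv_inv μ, key μ, h, ← key ν, Measure.inv_inv]
end HaarUniquenessFinite

section ForestGaugeAlgebra
variable {G : Type} [Group G] {b M : ℕ}

/-- **FOREST (AXIAL) GAUGE FIXING**: rotate `U` by the leaf gauge transformation of `(starDecimation U)⁻¹`, so that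
every star link becomes `1` (`starDecimation_forestFix`). [folklore] -/
def forestFix (b M : ℕ) (U : GaugeConfig 3 (b * M) G) : GaugeConfig 3 (b * M) G :=
  gaugeTransform (leafGauge b M (starDecimation b M U)⁻¹) U

/-- Leaf gauge functions multiply leafwise (contravariantly): `leafGauge (s h)⁻¹ · leafGauge h = leafGauge s⁻¹`.
[folklore] -/
theorem leafGauge_mul_inv_mul (s h : Edge 3 M → G) :
    (fun x => leafGauge b M (s * h)⁻¹ x * leafGauge b M h x) = leafGauge (G := G) b M s⁻¹ := by
  funext x
  unfold leafGauge
  by_cases hx : ∃ i : Fin 3, (x i).val % b = 1 ∧ ∀ j, j ≠ i → (x j).val % b = 0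
  · simp only [dif_pos hx, Pi.inv_apply, Pi.mul_apply, inv_inv, mul_inv_cancel_right]
  · simp only [dif_neg hx, mul_one]

/-- `leafGauge s · leafGauge s⁻¹ = 1`. [folklore] -/
theorem leafGauge_mul_leafGauge_inv (s : Edge 3 M → G) :
    (fun x => leafGauge b M s x * leafGauge b M s⁻¹ x) = fun _ => (1 : G) := by
  funext x
  unfold leafGauge
  by_cases hx : ∃ i : Fin 3, (x i).val % b = 1 ∧ ∀ j, j ≠ i → (x j).val % b = 0
  · simp only [dif_pos hx, Pi.inv_apply, inv_inv, inv_mul_cancel]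
  · simp only [dif_neg hx, mul_one]

/-- **Reconstruction**: `U` is the leaf gauge rotation, by its own forest field, of its forest gauge fixing. [folklore] -/
theorem gaugeTransform_leafGauge_forestFix (U : GaugeConfig 3 (b * M) G) :
    gaugeTransform (leafGauge b M (starDecimation b M U)) (forestFix b M U) = U := by
  unfold forestFix
  rw [gaugeTransform_gaugeTransform, leafGauge_mul_leafGauge_inv]
  exact gaugeTransform_one U

variable [NeZero M]

/-- After forest gauge fixing every star link is the identity. [folklore] -/
theorem starDecimation_forestFix (hb : 2 ≤ b) (U : GaugeConfig 3 (b * M) G) :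
    starDecimation b M (forestFix b M U) = 1 := by
  unfold forestFix
  rw [starDecimation_gaugeTransform_leafGauge hb]
  exact mul_inv_cancel _

/-- The forest gauge fixing is INVARIANT under every leaf gauge rotation. [folklore] -/
theorem forestFix_gaugeTransform_leafGauge (hb : 2 ≤ b) (h : Edge 3 M → G) (U : GaugeConfig 3 (b * M) G) :
    forestFix b M (gaugeTransform (leafGauge b M h) U) = forestFix b M U := by
  unfold forestFix
  rw [starDecimation_gaugeTransform_leafGauge hb, gaugeTransform_gaugeTransform, leafGauge_mul_inv_mul]
end ForestGaugeAlgebra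

section ForestDisintegration
variable {G : Type} [MeasurableSpace G] {N : ℕ} [Group G] [TopologicalSpace G] [IsTopologicalGroup G]
  [BorelSpace G] {b M : ℕ}

/-- Measurability of `g ↦ leafGauge g x`. [folklore] -/
theorem measurable_leafGauge_apply (x : Site 3 (b * M)) :
    Measurable (fun g : Edge 3 M → G => leafGauge b M g x) := by
  unfold leafGauge
  by_cases hx : ∃ i : Fin 3, (x i).val % b = 1 ∧ ∀ j, j ≠ i → (x j).val % b = 0
  · simp only [dif_pos hx]
    exact (measurable_pi_apply _).inv
  · simp only [dif_neg hx]
    exact measurable_const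

variable [SecondCountableTopology G]

/-- Joint measurability of the leaf gauge rotation `(a, s) ↦ a^{leafGauge s}`. [folklore] -/
theorem measurable_gaugeTransform_leafGauge :
    Measurable (fun p : GaugeConfig 3 (b * M) G × GaugeConfig 3 M G => gaugeTransform (leafGauge b M p.2) p.1) := by
  refine measurable_pi_lambda _ (fun e => ?_)
  have h1 : Measurable (fun p : GaugeConfig 3 (b * M) G × GaugeConfig 3 M G => leafGauge b M p.2 e.1) :=
    (measurable_leafGauge_apply e.1).comp measurable_snd
  have h2 : Measurable (fun p : GaugeConfig 3 (b * M) G × GaugeConfig 3 M G =>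
      leafGauge b M p.2 (e.1.shift e.2)) :=
    (measurable_leafGauge_apply (e.1.shift e.2)).comp measurable_snd
  have h3 : Measurable (fun p : GaugeConfig 3 (b * M) G × GaugeConfig 3 M G => p.1 e) :=
    (measurable_pi_apply e).comp measurable_fst
  show Measurable (fun p : GaugeConfig 3 (b * M) G × GaugeConfig 3 M G =>
    leafGauge b M p.2 e.1 * p.1 e * (leafGauge b M p.2 (e.1.shift e.2))⁻¹)
  exact (h1.mul h3).mul h2.inv

/-- Measurability of the forest gauge fixing. [folklore] -/
theorem measurable_forestFix : Measurable (forestFix (G := G) b M) := by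
  have hsd := measurable_starDecimation (G := G) b M
  have hp : Measurable (fun U : GaugeConfig 3 (b * M) G => (U, (starDecimation b M U)⁻¹)) :=
    measurable_id.prodMk hsd.inv
  exact measurable_gaugeTransform_leafGauge.comp hp

variable [NeZero M] [CompactSpace G]

/-- **THE FOREST DISINTEGRATION OF THE WILSON LAW** (tree gauge, kernel form): under the Wilson law on the torus of
side `b·M` (`2 ≤ b`, continuous `ρ`, every `β`), the forest gauge fixing `forestFix U` and the forest field
`starDecimation U` are INDEPENDENT, the latter distributed by product Haar:
`law(forestFix U, starDecimation U) = law(forestFix U) ⊗ Haar^{⊗E(M)}` — and `U` is recovered from the pair by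
the leaf gauge rotation (`gaugeTransform_leafGauge_forestFix`).  This is the measure-theoretic content of
«conditioning on a forest is a gauge image of the law itself» (AUDIT-theory2-g4.md §2.3–2.4). [folklore] -/
theorem map_forestFix_prod_starDecimation_wilsonMeasure (ρ : G →* Matrix (Fin N) (Fin N) ℂ) (hρ : Continuous ρ)
    (hb : 2 ≤ b) [NeZero (b * M)] (β : ℝ) :
    (wilsonMeasure (d := 3) (L := b * M) ρ β).map (fun U => (forestFix b M U, starDecimation b M U))
      = ((wilsonMeasure (d := 3) (L := b * M) ρ β).map (forestFix b M)).prod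
          (Measure.pi fun _ : Edge 3 M => haarProbability G) := by
  set μ := wilsonMeasure (d := 3) (L := b * M) ρ β with hμ
  haveI := isProbabilityMeasure_wilsonMeasure (d := 3) (L := b * M) (G := G) ρ hρ β
  have hff := measurable_forestFix (G := G) (b := b) (M := M)
  have hsd := measurable_starDecimation (G := G) b M
  have hpair : Measurable (fun U : GaugeConfig 3 (b * M) G => (forestFix b M U, starDecimation b M U)) :=
    hff.prodMk hsd
  set J := μ.map (fun U => (forestFix b M U, starDecimation b M U)) with hJ
  haveI : IsFiniteMeasure J := by rw [hJ]; infer_instance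
  -- invariance of the joint law under right multiplication of the forest field
  have hJinv : ∀ h : Edge 3 M → G,
      J.map (fun p : GaugeConfig 3 (b * M) G × GaugeConfig 3 M G => (p.1, p.2 * h)) = J := by
    intro h
    have hmul : Measurable (fun V : GaugeConfig 3 M G => V * h) :=
      measurable_pi_lambda _ (fun e => by
        have h1 : Measurable (fun V : GaugeConfig 3 M G => V e) := measurable_pi_apply e
        simpa only [Pi.mul_apply] using h1.mul_const (h e))
    have hR : Measurable (fun p : GaugeConfig 3 (b * M) G × GaugeConfig 3 M G => (p.1, p.2 * h)) :=
      measurable_fst.prodMk (hmul.comp measurable_snd)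
    have hγ : Measurable (gaugeTransform (leafGauge b M h) : GaugeConfig 3 (b * M) G → _) :=
      (WilsonGauge.measurePreserving_gaugeTransform (d := 3) (L := b * M) (leafGauge b M h)).measurable
    have hcomp : (fun p : GaugeConfig 3 (b * M) G × GaugeConfig 3 M G => (p.1, p.2 * h)) ∘
        (fun U => (forestFix b M U, starDecimation b M U))
        = (fun U => (forestFix b M U, starDecimation b M U)) ∘ gaugeTransform (leafGauge b M h) := by
      funext U
      simp only [Function.comp_apply, forestFix_gaugeTransform_leafGauge hb,
        starDecimation_gaugeTransform_leafGauge hb]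
    have hinv : μ.map (gaugeTransform (leafGauge b M h)) = μ :=
      wilsonMeasure_map_gaugeTransform_holds (d := 3) (L := b * M) (ρ := ρ) β (leafGauge b M h)
    rw [hJ, Measure.map_map hR hpair, hcomp, ← Measure.map_map hpair hγ, hinv]
  symm
  refine Measure.prod_eq (fun S B hS hB => ?_)
  -- the `S`-slice of the joint law, as a measure on the forest field
  set ν : Measure (GaugeConfig 3 M G) := (J.restrict (S ×ˢ Set.univ)).map Prod.snd with hν
  have hνapp : ∀ B' : Set (GaugeConfig 3 M G), MeasurableSet B' → ν B' = J (S ×ˢ B') := by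
    intro B' hB'
    rw [hν, Measure.map_apply measurable_snd hB', Measure.restrict_apply (measurable_snd hB')]
    congr 1
    ext p
    simp only [Set.mem_inter_iff, Set.mem_preimage, Set.mem_prod, Set.mem_univ, true_and, and_comm]
  haveI : IsFiniteMeasure ν := by rw [hν]; infer_instance
  haveI : ν.IsMulRightInvariant := by
    refine ⟨fun h => ?_⟩
    have hmul : Measurable (fun V : GaugeConfig 3 M G => V * h) :=
      measurable_pi_lambda _ (fun e => by
        have h1 : Measurable (fun V : GaugeConfig 3 M G => V e) := measurable_pi_apply e
        simpa only [Pi.mul_apply] using h1.mul_const (h e))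
    have hR : Measurable (fun p : GaugeConfig 3 (b * M) G × GaugeConfig 3 M G => (p.1, p.2 * h)) :=
      measurable_fst.prodMk (hmul.comp measurable_snd)
    ext B' hB'
    rw [Measure.map_apply hmul hB', hνapp _ (hmul hB'), hνapp _ hB']
    have hpre : (fun p : GaugeConfig 3 (b * M) G × GaugeConfig 3 M G => (p.1, p.2 * h)) ⁻¹' (S ×ˢ B')
        = S ×ˢ ((fun V : GaugeConfig 3 M G => V * h) ⁻¹' B') := by
      ext p; simp only [Set.mem_preimage, Set.mem_prod]
    rw [← hpre, ← Measure.map_apply hR (hS.prod hB'), hJinv h]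
  -- total mass of the slice
  have hmass : ν Set.univ = (μ.map (forestFix b M)) S := by
    rw [hνapp _ MeasurableSet.univ, hJ, Measure.map_apply hpair (hS.prod MeasurableSet.univ),
      Measure.map_apply hff hS]
    congr 1
    ext U
    simp only [Set.mem_preimage, Set.mem_prod, Set.mem_univ, and_true]
  -- uniqueness of right-invariant finite measures: the slice is (its mass) × product Haar
  set π : Measure (GaugeConfig 3 M G) := Measure.pi fun _ : Edge 3 M => haarProbability G with hπ
  haveI : IsFiniteMeasure ((ν Set.univ) • π) :=
    ⟨by rw [Measure.smul_apply, smul_eq_mul]; exact ENNReal.mul_lt_top (measure_lt_top _ _) (measure_lt_top _ _)⟩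
  haveI : ((ν Set.univ) • π).IsMulRightInvariant :=
    ⟨fun g => by rw [Measure.map_smul, map_mul_right_eq_self]⟩
  have hνeq : ν = (ν Set.univ) • π :=
    eq_of_isMulRightInvariant_of_measure_univ_eq _ _
      (by rw [Measure.smul_apply, smul_eq_mul, measure_univ (μ := π), mul_one])
  rw [← hνapp _ hB, hνeq, Measure.smul_apply, smul_eq_mul, hmass]

/-- The **FOREST AVERAGE** of a fine observable `f` against a law `ν` of gauge-fixed configurations, as a function of
the forest field `s`: `Ψ_f(s) = ∫ f(a^{leafGauge s}) dν(a)`. [folklore] -/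
def forestAverage (b M : ℕ) (ν : Measure (GaugeConfig 3 (b * M) G)) (f : GaugeConfig 3 (b * M) G → ℝ)
    (s : GaugeConfig 3 M G) : ℝ :=
  ∫ a, f (gaugeTransform (leafGauge b M s) a) ∂ν

/-- **EXACT CONDITIONAL EXPECTATIONS GIVEN THE FOREST** (the object of clause (b)(ii) of `IRConjecture3` for the forest
family): under the Wilson law `μ` on the torus of side `b·M` (`2 ≤ b`, continuous `ρ`), for every integrable measurable
`f`, `E_μ[f | σ(starDecimation)] = Ψ_f ∘ starDecimation` a.s., with `Ψ_f` the forest average against the law of the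
forest gauge fixing `μ ∘ forestFix⁻¹`.  No locality or smallness is used: it is disintegration of product Haar along a
gauge forest. [folklore] -/
theorem condExp_forest_ae_eq_forestAverage (ρ : G →* Matrix (Fin N) (Fin N) ℂ) (hρ : Continuous ρ) (hb : 2 ≤ b)
    [NeZero (b * M)] (β : ℝ) {f : GaugeConfig 3 (b * M) G → ℝ} (hfm : Measurable f)
    (hfi : Integrable f (wilsonMeasure (d := 3) (L := b * M) ρ β)) :
    condExp (MeasurableSpace.comap (starDecimation (G := G) b M) inferInstance) (wilsonMeasure (d := 3) (L := b * M) ρ β) f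
      =ᵐ[wilsonMeasure (d := 3) (L := b * M) ρ β]
    fun U => forestAverage b M ((wilsonMeasure (d := 3) (L := b * M) ρ β).map (forestFix b M)) f
      (starDecimation b M U) := by
  set μ := wilsonMeasure (d := 3) (L := b * M) ρ β with hμ
  haveI := isProbabilityMeasure_wilsonMeasure (d := 3) (L := b * M) (G := G) ρ hρ β
  have hff := measurable_forestFix (G := G) (b := b) (M := M)
  have hsd := measurable_starDecimation (G := G) b M
  have hpair : Measurable (fun U : GaugeConfig 3 (b * M) G => (forestFix b M U, starDecimation b M U)) :=
    hff.prodMk hsd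
  have hT := measurable_gaugeTransform_leafGauge (G := G) (b := b) (M := M)
  set ν := μ.map (forestFix b M) with hν
  haveI : IsProbabilityMeasure ν := Measure.isProbabilityMeasure_map hff.aemeasurable
  set π : Measure (GaugeConfig 3 M G) := Measure.pi fun _ : Edge 3 M => haarProbability G with hπ
  have hJ : μ.map (fun U => (forestFix b M U, starDecimation b M U)) = ν.prod π :=
    map_forestFix_prod_starDecimation_wilsonMeasure ρ hρ hb β
  have hsdπ : μ.map (starDecimation b M) = π := map_starDecimation_wilsonMeasure_eq_pi ρ hρ hb β
  -- the observable read through the reconstruction map `(a, s) ↦ a^{leafGauge s}`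
  set F : GaugeConfig 3 (b * M) G × GaugeConfig 3 M G → ℝ :=
    fun p => f (gaugeTransform (leafGauge b M p.2) p.1) with hF_def
  have hF : Measurable F := hfm.comp hT
  have hrec : ∀ U : GaugeConfig 3 (b * M) G, F (forestFix b M U, starDecimation b M U) = f U := fun U => by
    simp only [hF_def, gaugeTransform_leafGauge_forestFix]
  have hFJ : Integrable F (ν.prod π) := by
    rw [← hJ]
    refine (integrable_map_measure hF.aestronglyMeasurable hpair.aemeasurable).2 ?_
    have : F ∘ (fun U => (forestFix b M U, starDecimation b M U)) = f := funext hrec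
    rw [this]; exact hfi
  -- the forest average is a strongly measurable, π-integrable function of the forest field
  set Ψ : GaugeConfig 3 M G → ℝ := fun s => ∫ a, F (a, s) ∂ν with hΨ_def
  have hΨm : StronglyMeasurable Ψ := hF.stronglyMeasurable.integral_prod_left'
  have hΨi : Integrable Ψ π := hFJ.integral_prod_right
  have hΨsd : Integrable (fun U => Ψ (starDecimation b M U)) μ := by
    have h1 : Integrable Ψ (μ.map (starDecimation b M)) := by rw [hsdπ]; exact hΨi
    exact (integrable_map_measure hΨm.aestronglyMeasurable hsd.aemeasurable).1 h1
  have hm : MeasurableSpace.comap (starDecimation (G := G) b M) inferInstance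
      ≤ (inferInstance : MeasurableSpace (GaugeConfig 3 (b * M) G)) := hsd.comap_le
  have hsdm : Measurable[MeasurableSpace.comap (starDecimation (G := G) b M) inferInstance] (starDecimation b M) :=
    measurable_iff_comap_le.2 le_rfl
  have hgm : StronglyMeasurable[MeasurableSpace.comap (starDecimation (G := G) b M) inferInstance]
      (fun U => Ψ (starDecimation b M U)) := hΨm.comp_measurable hsdm
  show condExp (MeasurableSpace.comap (starDecimation (G := G) b M) inferInstance) μ f
      =ᵐ[μ] fun U => Ψ (starDecimation b M U)
  refine (ae_eq_condExp_of_forall_setIntegral_eq hm hfi (fun s _ _ => hΨsd.integrableOn) ?_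
    hgm.aestronglyMeasurable).symm
  rintro _ ⟨B, hB, rfl⟩ -
  -- both sides are `∫ 1_B(s) Ψ(s) dπ(s)`
  have hpre : MeasurableSet (starDecimation b M ⁻¹' B) := hsd hB
  rw [← integral_indicator hpre, ← integral_indicator hpre]
  have lhs : ∫ U, (starDecimation b M ⁻¹' B).indicator (fun U => Ψ (starDecimation b M U)) U ∂μ
      = ∫ s, B.indicator Ψ s ∂π := by
    have h1 : (starDecimation b M ⁻¹' B).indicator (fun U => Ψ (starDecimation b M U))
        = fun U => B.indicator Ψ (starDecimation b M U) := by
      funext U; exact Set.indicator_comp_right (s := B) (starDecimation b M) (g := Ψ) (x := U)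
    rw [h1, ← hsdπ, integral_map hsd.aemeasurable]
    exact ((hΨm.indicator hB).aestronglyMeasurable)
  have rhs : ∫ U, (starDecimation b M ⁻¹' B).indicator f U ∂μ = ∫ s, B.indicator Ψ s ∂π := by
    have h1 : (starDecimation b M ⁻¹' B).indicator f
        = fun U => (Prod.snd ⁻¹' B : Set (GaugeConfig 3 (b * M) G × GaugeConfig 3 M G)).indicator F
            (forestFix b M U, starDecimation b M U) := by
      funext U
      by_cases hU : starDecimation b M U ∈ B
      · have hU' : U ∈ starDecimation b M ⁻¹' B := hU
        have hU'' : (forestFix b M U, starDecimation b M U)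
            ∈ (Prod.snd ⁻¹' B : Set (GaugeConfig 3 (b * M) G × GaugeConfig 3 M G)) := hU
        rw [Set.indicator_of_mem hU', Set.indicator_of_mem hU'', hrec]
      · have hU' : U ∉ starDecimation b M ⁻¹' B := hU
        have hU'' : (forestFix b M U, starDecimation b M U)
            ∉ (Prod.snd ⁻¹' B : Set (GaugeConfig 3 (b * M) G × GaugeConfig 3 M G)) := hU
        rw [Set.indicator_of_notMem hU', Set.indicator_of_notMem hU'']
    have hBm : MeasurableSet (Prod.snd ⁻¹' B : Set (GaugeConfig 3 (b * M) G × GaugeConfig 3 M G)) :=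
      measurable_snd hB
    rw [h1, ← integral_map hpair.aemeasurable ((hF.indicator hBm).aestronglyMeasurable), hJ,
      integral_prod_symm _ (hFJ.indicator hBm)]
    refine integral_congr_ae (Filter.Eventually.of_forall (fun s => ?_))
    by_cases hs : s ∈ B
    · simp only [Set.indicator_of_mem hs, hΨ_def]
      refine integral_congr_ae (Filter.Eventually.of_forall (fun a => ?_))
      exact Set.indicator_of_mem (by exact hs) F
    · simp only [Set.indicator_of_notMem hs]
      rw [← integral_zero (α := GaugeConfig 3 (b * M) G) ℝ]
      refine integral_congr_ae (Filter.Eventually.of_forall (fun a => ?_))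
      exact Set.indicator_of_notMem (by exact hs) F
  rw [lhs, rhs]

/-- The same, phrased with the tree's `coarseSigma` / `fineLaw` of the forest block family (every `M ≥ 1`). [folklore] -/
theorem condExp_coarseSigma_forestFamily_ae_eq (ρ : G →* Matrix (Fin N) (Fin N) ℂ) (hρ : Continuous ρ)
    {bf : ℝ → ℕ} (hbf : ∀ β, 0 < bf β) (β : ℝ) (h2 : 2 ≤ bf β) [NeZero (bf β * M)]
    {f : GaugeConfig 3 (bf β * M) G → ℝ} (hfm : Measurable f)
    (hfi : Integrable f (wilsonMeasure (d := 3) (L := bf β * M) ρ β)) :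
    condExp (coarseSigma (forestFamily bf hbf) β M) (fineLaw ρ β (forestFamily bf hbf) M) f
      =ᵐ[fineLaw ρ β (forestFamily bf hbf) M]
    fun U => forestAverage (bf β) M ((wilsonMeasure (d := 3) (L := bf β * M) ρ β).map (forestFix (bf β) M)) f
      (starDecimation (bf β) M U) :=
  condExp_forest_ae_eq_forestAverage ρ hρ h2 β hfm hfi

/-- The **FOREST COVARIANCE** of two fine observables against a law `ν` of gauge-fixed configurations, as a function
of the forest field. [folklore] -/
def forestCov (b M : ℕ) (ν : Measure (GaugeConfig 3 (b * M) G)) (f g : GaugeConfig 3 (b * M) G → ℝ)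
    (s : GaugeConfig 3 M G) : ℝ :=
  forestAverage b M ν (fun U => f U * g U) s - forestAverage b M ν f s * forestAverage b M ν g s

/-- **EXACT CONDITIONAL COVARIANCES GIVEN THE FOREST** (the object of clause (b)(i) of `IRConjecture3` for the forest
family): `condCov(f, g | σ(starDecimation)) = forestCov(f, g) ∘ starDecimation` a.s. under the Wilson law, for
integrable measurable `f`, `g`, `f·g`. [folklore] -/
theorem condCov_forest_ae_eq_forestCov (ρ : G →* Matrix (Fin N) (Fin N) ℂ) (hρ : Continuous ρ) (hb : 2 ≤ b)
    [NeZero (b * M)] (β : ℝ) {f g : GaugeConfig 3 (b * M) G → ℝ} (hfm : Measurable f) (hgm : Measurable g)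
    (hfi : Integrable f (wilsonMeasure (d := 3) (L := b * M) ρ β))
    (hgi : Integrable g (wilsonMeasure (d := 3) (L := b * M) ρ β))
    (hfgi : Integrable (fun U => f U * g U) (wilsonMeasure (d := 3) (L := b * M) ρ β)) :
    (fun U => condExp (MeasurableSpace.comap (starDecimation (G := G) b M) inferInstance)
          (wilsonMeasure (d := 3) (L := b * M) ρ β) (fun U => f U * g U) U
        - condExp (MeasurableSpace.comap (starDecimation (G := G) b M) inferInstance)
            (wilsonMeasure (d := 3) (L := b * M) ρ β) f U
          * condExp (MeasurableSpace.comap (starDecimation (G := G) b M) inferInstance)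
            (wilsonMeasure (d := 3) (L := b * M) ρ β) g U)
      =ᵐ[wilsonMeasure (d := 3) (L := b * M) ρ β]
    fun U => forestCov b M ((wilsonMeasure (d := 3) (L := b * M) ρ β).map (forestFix b M)) f g
      (starDecimation b M U) := by
  have h1 := condExp_forest_ae_eq_forestAverage ρ hρ hb β (f := fun U => f U * g U) (hfm.mul hgm) hfgi
  have h2 := condExp_forest_ae_eq_forestAverage ρ hρ hb β hfm hfi
  have h3 := condExp_forest_ae_eq_forestAverage ρ hρ hb β hgm hgi
  filter_upwards [h1, h2, h3] with U e1 e2 e3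
  rw [forestCov, e1, e2, e3]

/-- The same, phrased with the tree's `condCov` / `coarseSigma` / `fineLaw` of the forest block family. [folklore] -/
theorem condCov_forestFamily_ae_eq (ρ : G →* Matrix (Fin N) (Fin N) ℂ) (hρ : Continuous ρ)
    {bf : ℝ → ℕ} (hbf : ∀ β, 0 < bf β) (β : ℝ) (h2 : 2 ≤ bf β) [NeZero (bf β * M)]
    {f g : GaugeConfig 3 (bf β * M) G → ℝ} (hfm : Measurable f) (hgm : Measurable g)
    (hfi : Integrable f (wilsonMeasure (d := 3) (L := bf β * M) ρ β))
    (hgi : Integrable g (wilsonMeasure (d := 3) (L := bf β * M) ρ β))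
    (hfgi : Integrable (fun U => f U * g U) (wilsonMeasure (d := 3) (L := bf β * M) ρ β)) :
    condCov (forestFamily bf hbf) β M (fineLaw ρ β (forestFamily bf hbf) M) f g
      =ᵐ[fineLaw ρ β (forestFamily bf hbf) M]
    fun U => forestCov (bf β) M ((wilsonMeasure (d := 3) (L := bf β * M) ρ β).map (forestFix (bf β) M)) f g
      (starDecimation (bf β) M U) :=
  condCov_forest_ae_eq_forestCov ρ hρ h2 β hfm hgm hfi hgi hfgi
end ForestDisintegration

end Summit.Ventures.YMGap.YM3IR

end
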